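import Summits.CriticalPhenomena.PercolationContinuityZ3.Theorems.Transplant.GrigorchukPowerNcHaraSladeDefs
import Summits.CriticalPhenomena.PercolationContinuityZ3.Theorems.Transplant.GrigorchukPowerSmallParam
import HarnessLib

/-!
# W4 DEFS-C — the IMPLICIT lace kernel on `Cay(𝔊^k)` and its norm (`tauFun`, `deltaFun`, `IsLaceKernel`, `omegaV`, `kappa0`, `laceNormE`, `laceBound`), with the
# critic's junk-exclusion API

Definition file (`--kind definition`, `--supports stmt-CriticalPhenomena-4575 --as helper`), lane `prim-bschramm`, seat `prim-bschramm-gen-1` gen 12 (GEN pen); default item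
DEFS-C of lead g29 #9900 (design desk p3 g42 def-list line; refuter p5-g35; referee p1-g33).  builds on p205010 (kernel theorem, internal audit signed; external expert review
pending) — nothing here uses p205010.  No instance, no notation, no sorry, no `@[conjecture]`; nothing is asserted about any `Cay(𝔊^k)`: the seven definitions are the
§2 «DEFS-C» block of the W4 skeleton of record (HOME/w-ideation/W4/NcHaraSladeGk_birth.lean v1.5, :47–:75) VERBATIM, homed in the tree so that the two open nc-lace stubs
S3a `stub_laceBound` / S3b `stub_improvement_of_laceBound` become statable as tree files; the API (§2) is w-crit-1 g2's PROVED junk-exclusion block (Probe-K1v5-Omega.lean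
a7f1b251 §OmegaBounds) ported onto these definitions, plus one-line unfoldings.

* `tauFun k p g = τ_p(1, g)` on `Cay(𝔊^k)`; `deltaFun k g = [g = 1]`.
* `IsLaceKernel k p K`: `K ∈ ℓ¹` and `Ψ := δ + K` solves the renewal (lace-expansion) identity `τ_p = Ψ + Ψ ⋆ (p·𝟙_{S_k}) ⋆ τ_p` (left-invariant convolution on `𝔊^k`).
  Nothing asserts that a lace kernel exists.
* `omegaV ξ x = ‖ξ‖² − ⟨ξ, ρ(x)ξ⟩` (the nc `1 − cos k·x`), `kappa0 k ξ = |S_k|⁻¹ Σ_{s∈S_k} ω_ξ(s)`, `laceNormE k K ∈ [0,∞]` = `‖K‖_{ℓ¹} ⊔ sup_ξ (Σ_x |K x| ω_ξ(x)) / κ₀(ξ)`,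
  `laceBound k p = inf over lace kernels of laceNormE` (`⊤` if none).
[cite: HeydenreichVanDerHofstad2017, §6.2 (lace expansion identity), §8.3 (1 − D̂(k); Prop. 8.3)] [cite: HaraSlade1990, §1 (two-point function), §4]
-/

noncomputable section

namespace Summit.CriticalPhenomena.PercolationContinuityZ3.Theorems.Transplant

namespace Grigorchuk

namespace NcHaraSlade

open SimpleGraph Literature.Probability.Percolation
open scoped ENNReal Classical

/-! ## §1 DEFS-C (skeleton v1.5 §2, verbatim) -/

/-- `τ_p` as a function on the group: `τ_p(g) := P_p(1 ↔ g)` on `Cay(𝔊^k)`. [cite: HaraSlade1990, §1 (two-point function)] -/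
def tauFun (k : ℕ) (p : unitInterval) (g : GPow k) : ℝ := conn (gkCay k) p 1 g

/-- The Kronecker delta at the identity. [folklore] -/
def deltaFun (k : ℕ) (g : GPow k) : ℝ := if g = 1 then 1 else 0

/-- **Lace kernel, implicit form**: `K` is summable and `Ψ := δ + K` solves the renewal equation `τ_p = Ψ + Ψ ⋆ (p·𝟙_{S_k}) ⋆ τ_p` on `𝔊^k`
(left-invariant kernels, `(a ⋆ b)(g) = Σ_y a(y) b(y⁻¹g)`). Nothing asserts existence here. [cite: HeydenreichVanDerHofstad2017, §6.2 (the lace expansion identity)] -/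
def IsLaceKernel (k : ℕ) (p : unitInterval) (K : GPow k → ℝ) : Prop :=
  Summable (fun x => |K x|) ∧
    ∀ g : GPow k, tauFun k p g = deltaFun k g + K g +
      (p : ℝ) * ∑' x : GPow k, (deltaFun k x + K x) * ∑ s ∈ gkGens k, tauFun k p ((x * s)⁻¹ * g)

/-- `ω_ξ(x) = ‖ξ‖² − ⟨ξ, ρ(x)ξ⟩` for a finitely supported real test vector (`(ρ(x)ξ)(y) = ξ(yx)`): the nc replacement of `1 − cos(k·x)`.
[cite: HeydenreichVanDerHofstad2017, §8.3 (the weight 1 − cos k·x)] -/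
def omegaV {k : ℕ} (ξ : GPow k →₀ ℝ) (x : GPow k) : ℝ :=
  (∑ y ∈ ξ.support, ξ y * ξ y) - ∑ y ∈ ξ.support, ξ y * ξ (y * x)

/-- `κ₀(ξ) = |S_k|⁻¹ Σ_{s ∈ S_k} ω_ξ(s)` (the Laplacian form; `|S_k| = 4k`). [cite: HeydenreichVanDerHofstad2017, §8.3 (1 − D̂(k))] -/
def kappa0 (k : ℕ) (ξ : GPow k →₀ ℝ) : ℝ := (∑ s ∈ gkGens k, omegaV ξ s) / (4 * (k : ℝ))

/-- The LACE NORM of a kernel in `[0, ∞]`: `max(‖K‖_{ℓ¹}, best K₃ in Σ_x |K(x)| ω_ξ(x) ≤ K₃ κ₀(ξ))`. [cite: HeydenreichVanDerHofstad2017, Prop. 8.3] -/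
def laceNormE (k : ℕ) (K : GPow k → ℝ) : ℝ≥0∞ :=
  (∑' x : GPow k, ENNReal.ofReal |K x|) ⊔
    ⨆ (ξ : GPow k →₀ ℝ) (_ : 0 < kappa0 k ξ), ENNReal.ofReal ((∑' x : GPow k, |K x| * omegaV ξ x) / kappa0 k ξ)

/-- The best lace norm available at `(k, p)`: `⊤` if no lace kernel exists. [cite: HeydenreichVanDerHofstad2017, Prop. 8.3] -/
def laceBound (k : ℕ) (p : unitInterval) : ℝ≥0∞ := ⨅ (K : GPow k → ℝ) (_ : IsLaceKernel k p K), laceNormE k K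

/-! ## §2 API: unfoldings, and the critic's junk-exclusion lemmas (w-crit-1 g2, Probe-Ω a7f1b251 §OmegaBounds, ported) -/

variable {k : ℕ}

/-- `τ_p(g) ≥ 0`. [folklore] -/
theorem tauFun_nonneg (p : unitInterval) (g : GPow k) : 0 ≤ tauFun k p g := conn_nonneg _ p 1 g

/-- `τ_p(g) ≤ 1`. [folklore] -/
theorem tauFun_le_one (p : unitInterval) (g : GPow k) : tauFun k p g ≤ 1 := conn_le_one _ p 1 g

/-- `τ_p(1) = 1`. [folklore] -/
theorem tauFun_one (p : unitInterval) : tauFun k p 1 = 1 := conn_self _ p 1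

/-- `δ(1) = 1`. [folklore] -/
theorem deltaFun_one : deltaFun k 1 = 1 := if_pos rfl

/-- `δ(g) = 0` for `g ≠ 1`. [folklore] -/
theorem deltaFun_of_ne_one {g : GPow k} (hg : g ≠ 1) : deltaFun k g = 0 := if_neg hg

/-- A lace kernel is absolutely summable (first clause of `IsLaceKernel`). [folklore] -/
theorem IsLaceKernel.summable_abs {p : unitInterval} {K : GPow k → ℝ} (hK : IsLaceKernel k p K) : Summable fun x => |K x| := hK.1

/-- A lace kernel solves the renewal identity (second clause of `IsLaceKernel`). [cite: HeydenreichVanDerHofstad2017, §6.2] -/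
theorem IsLaceKernel.renewal {p : unitInterval} {K : GPow k → ℝ} (hK : IsLaceKernel k p K) (g : GPow k) :
    tauFun k p g = deltaFun k g + K g + (p : ℝ) * ∑' x : GPow k, (deltaFun k x + K x) * ∑ s ∈ gkGens k, tauFun k p ((x * s)⁻¹ * g) := hK.2 g

/-- `laceBound ≤ laceNormE K` for every lace kernel `K`. [folklore] -/
theorem laceBound_le {p : unitInterval} {K : GPow k → ℝ} (hK : IsLaceKernel k p K) : laceBound k p ≤ laceNormE k K := iInf₂_le K hK

/-- No lace kernel ⇒ `laceBound = ⊤`. [folklore] -/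
theorem laceBound_eq_top {p : unitInterval} (h : ∀ K : GPow k → ℝ, ¬ IsLaceKernel k p K) : laceBound k p = ⊤ := by
  unfold laceBound
  simp [h]

/-- `‖K‖_{ℓ¹}` (in `[0,∞]`) is below the lace norm. [folklore] -/
theorem tsum_ofReal_abs_le_laceNormE (K : GPow k → ℝ) : ∑' x : GPow k, ENNReal.ofReal |K x| ≤ laceNormE k K := le_sup_left

/-- `Σ_y ξ(yx)² ≤ Σ_y ξ(y)²` over `ξ.support` (injectivity of `y ↦ y·x`). [folklore] -/
theorem sum_shift_mul_self_le (ξ : GPow k →₀ ℝ) (x : GPow k) :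
    ∑ y ∈ ξ.support, ξ (y * x) * ξ (y * x) ≤ ∑ y ∈ ξ.support, ξ y * ξ y := by
  have himg : ∑ y ∈ ξ.support, ξ (y * x) * ξ (y * x) = ∑ z ∈ ξ.support.image (· * x), ξ z * ξ z := by
    rw [Finset.sum_image]
    intro a _ b _ h
    exact mul_right_cancel h
  have hsub : ∑ z ∈ ξ.support.image (· * x), ξ z * ξ z ≤ ∑ z ∈ ξ.support.image (· * x) ∪ ξ.support, ξ z * ξ z :=
    Finset.sum_le_sum_of_subset_of_nonneg Finset.subset_union_left fun z _ _ => mul_self_nonneg _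
  have heq : ∑ z ∈ ξ.support, ξ z * ξ z = ∑ z ∈ ξ.support.image (· * x) ∪ ξ.support, ξ z * ξ z := by
    apply Finset.sum_subset Finset.subset_union_right
    intro z _ hz
    have : ξ z = 0 := by simpa using hz
    simp [this]
  rw [himg, heq]
  exact hsub

/-- `|⟨ξ, ρ(x)ξ⟩| ≤ ‖ξ‖²` (Cauchy–Schwarz + `sum_shift_mul_self_le`). [folklore] -/
theorem abs_sum_shift_le (ξ : GPow k →₀ ℝ) (x : GPow k) :
    |∑ y ∈ ξ.support, ξ y * ξ (y * x)| ≤ ∑ y ∈ ξ.support, ξ y * ξ y := by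
  set A := ∑ y ∈ ξ.support, ξ y * ξ y with hA
  have hA0 : 0 ≤ A := Finset.sum_nonneg fun y _ => mul_self_nonneg _
  have hcs : (∑ y ∈ ξ.support, ξ y * ξ (y * x)) ^ 2 ≤
      (∑ y ∈ ξ.support, ξ y ^ 2) * ∑ y ∈ ξ.support, ξ (y * x) ^ 2 :=
    Finset.sum_mul_sq_le_sq_mul_sq _ _ _
  have h1 : (∑ y ∈ ξ.support, ξ y ^ 2) = A := by simp only [hA, sq]
  have h2 : (∑ y ∈ ξ.support, ξ (y * x) ^ 2) ≤ A := by
    simpa only [sq] using sum_shift_mul_self_le ξ x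
  have hsq : (∑ y ∈ ξ.support, ξ y * ξ (y * x)) ^ 2 ≤ A ^ 2 := by
    calc (∑ y ∈ ξ.support, ξ y * ξ (y * x)) ^ 2
        ≤ (∑ y ∈ ξ.support, ξ y ^ 2) * ∑ y ∈ ξ.support, ξ (y * x) ^ 2 := hcs
      _ ≤ A * A := by rw [h1]; exact mul_le_mul_of_nonneg_left h2 hA0
      _ = A ^ 2 := (sq A).symm
  calc |∑ y ∈ ξ.support, ξ y * ξ (y * x)| ≤ |A| := sq_le_sq.mp hsq
    _ = A := abs_of_nonneg hA0

/-- **`0 ≤ ω_ξ(x)`**. [cite: HeydenreichVanDerHofstad2017, §8.3] -/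
theorem omegaV_nonneg (ξ : GPow k →₀ ℝ) (x : GPow k) : 0 ≤ omegaV ξ x := by
  have h := abs_sum_shift_le ξ x
  have h' := le_abs_self (∑ y ∈ ξ.support, ξ y * ξ (y * x))
  unfold omegaV
  linarith

/-- **`ω_ξ(x) ≤ 2‖ξ‖²`**. [cite: HeydenreichVanDerHofstad2017, §8.3] -/
theorem omegaV_le (ξ : GPow k →₀ ℝ) (x : GPow k) : omegaV ξ x ≤ 2 * ∑ y ∈ ξ.support, ξ y * ξ y := by
  have h := abs_sum_shift_le ξ x
  have h' := neg_abs_le (∑ y ∈ ξ.support, ξ y * ξ (y * x))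
  unfold omegaV
  linarith

/-- The weighted series in `laceNormE` is summable for every absolutely summable kernel: no Real-`tsum` junk inside `laceBound`. [folklore] -/
theorem summable_abs_mul_omegaV (ξ : GPow k →₀ ℝ) {K : GPow k → ℝ} (hK : Summable fun x => |K x|) :
    Summable fun x => |K x| * omegaV ξ x :=
  Summable.of_nonneg_of_le (fun x => mul_nonneg (abs_nonneg _) (omegaV_nonneg ξ x))
    (fun x => mul_le_mul_of_nonneg_left (omegaV_le ξ x) (abs_nonneg _)) (hK.mul_right _)

/-- Generators are `≠ 1` (a letter pins its coordinate). [folklore] -/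
theorem ne_one_of_mem_gkGens {s : GPow k} (hs : s ∈ gkGens k) : s ≠ 1 := by
  rw [gkGens_eq_image, Finset.mem_image] at hs
  obtain ⟨⟨i, y⟩, -, rfl⟩ := hs
  rw [Ne, Pi.mulSingle_eq_one_iff]
  exact toG_ne_one y

/-- At `ξ = δ_1`: `ω_{δ_1}(s) = 1` for every generator, so `κ₀(δ_1) = 4k/(4k) = 1` (`k ≥ 1`) — the `⨆` in `laceNormE` ranges over a NON-EMPTY family.
[cite: HeydenreichVanDerHofstad2017, §8.3] -/
theorem kappa0_single_one (hk : 1 ≤ k) : kappa0 k (Finsupp.single (1 : GPow k) (1 : ℝ)) = 1 := by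
  have hω : ∀ s ∈ gkGens k, omegaV (Finsupp.single (1 : GPow k) (1 : ℝ)) s = 1 := by
    intro s hs
    have hne : s ≠ 1 := ne_one_of_mem_gkGens hs
    simp [omegaV, Finsupp.single_apply, Ne.symm hne]
  have hk' : (4 * (k : ℝ)) ≠ 0 := by positivity
  unfold kappa0
  rw [Finset.sum_congr rfl hω, Finset.sum_const, card_gkGens, nsmul_eq_mul, mul_one]
  push_cast
  exact div_self hk'

/-- Consequently the weighted `δ_1`-term bounds `laceNormE` from below (for `k ≥ 1`): the weighted part is a genuine constraint. [cite: HeydenreichVanDerHofstad2017, Prop. 8.3] -/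
theorem ofReal_tsum_omegaV_single_le_laceNormE (hk : 1 ≤ k) (K : GPow k → ℝ) :
    ENNReal.ofReal (∑' x, |K x| * omegaV (Finsupp.single (1 : GPow k) (1 : ℝ)) x) ≤ laceNormE k K := by
  refine le_sup_of_le_right (le_iSup₂_of_le (Finsupp.single (1 : GPow k) (1 : ℝ)) ?_ ?_)
  · rw [kappa0_single_one hk]; norm_num
  · rw [kappa0_single_one hk, div_one]

end NcHaraSlade

end Grigorchuk

end Summit.CriticalPhenomena.PercolationContinuityZ3.Theorems.Transplant

end
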